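import Summits.QuantumAdvantage.QuantumAdvantage.Theses.NeedleThreshold
import Literature.Computability.QuantumComplexity.GuidedPauliHamiltonian
import Literature.Computability.Complexity.PromiseProofs

/-!
# Line `birth` — BC3 skeleton for the crux `GuidedHardness` (stmt-QuantumAdvantage-9895)

Route `NeedleThreshold` (route-QuantumAdvantage-NeedleThreshold, refutation side: `closes` concludes
`¬ QuantumAdvantage`), crux rank 2:

  `GuidedHardness := ∃ (K : ℕ) (χ₀ : ℝ), 0 < χ₀ ∧ ∀ L ∈ BQP, (ofLanguage L).PolyTimeReducible GLH(K, χ₀)`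

— BQP-hardness (Karp, as promise problems) of the guided Pauli-Hamiltonian ground-energy DECISION
problem at relative precision `1/(K·⌊log₂ n⌋² + 1)` with signed subset-state guides of constant overlap
`χ₀`.  In the route file the problem `GLH(K, χ₀)` is inlined as one `PromiseProblem.ofEncoding …` term;
it is, by `rfl`, the Literature object
`Literature.Computability.QuantumComplexity.guidedPauliHamiltonianProblem K χ₀`
(`GuidedPauliHamiltonian.lean`, `guidedPauliHamiltonianProblem_eq`; re-checked here: `guidedHardness_iff`
below is `Iff.rfl`).  Its inverse-polynomial sibling (schedule `g(n) = n^c + c`, relative promise gap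
`b − a ≥ 1/(n^c + c)`, the regime of the printed hardness theorem) is
`guidedPauliHamiltonianProblem' c χ₀` (same file).  Below, `GLH'(c, χ) := guidedPauliHamiltonianProblem' c χ`
and `GLH(K, χ) := guidedPauliHamiltonianProblem K χ`.

THE LINE (= the route's own TWO-LAYER PLAN for this node, `GuidedHardness ⇐ ClockHardness →
GuidedAmplification`, k = 2, glue = transitivity of promise Karp reductions):

* `stub_clockHardness` (KNOWN IN PRINT modulo transcription; size XL in Lean) — for some `c : ℕ` and
  `χ₁ > 0`, every `L ∈ BQP` Karp-reduces (as `ofLanguage L`) to `GLH'(c, χ₁)`: BQP-hardness of guided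
  ground-energy decisions at RELATIVE precision `1/poly` with a semi-classical (subset-state) guide.
  This is [GharibianLegall2022, Thm 2] (BQP-hard for 6-local `H`, `‖H‖ ≤ 1`, `b − a = Ω(1/poly)`,
  subset-state guide `u` with `‖Π_H u‖ ≥ δ`, any `δ < 1/√2 − 1/poly`; overlap towards `1 − 1/poly` in
  [CadeEtAl2022]) transcribed to this instance format: Kitaev/Feynman clock Hamiltonian of the
  (error-reduced) uniform Clifford+T circuit, whose propagator terms have Pauli weights in `2^{-r}ℤ[√2]`
  — scale by `2^r` to land in the weight ring `ℤ + ℤ√2` (thresholds are relative to the Pauli 1-norm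
  `Λ`, so scaling is free); pre-idling clock steps give the subset-state guide over clock values
  `|x⟩|0…0⟩|1^t 0^{T−t}⟩`; the YES eigenvector is the perturbed history state (non-degenerate, gapped
  kernel of `H_in + H_prop + H_clock`, plus `H_out` of energy `≤ ε/(T+1)` with `ε` exponentially small
  after majority amplification), the NO bound is Kitaev's `Ω((1 − √ε)/T³)`; relative gap
  `1/poly(|x|) ≥ 1/(n'^c + c)` after padding `n' ≥ |x|`.  Why it might fail AS TYPED: only through a
  format delta — ONE exact eigenvector with overlap `≥ χ₁` (needs the perturbation step, not just
  `‖Π_H u‖`), integrality of weights (scaling), and the `FP` witness of the compiler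
  `x ↦ ⟨clock instance⟩` (uniformity of the family composed with a poly-time circuit-to-Hamiltonian map,
  cf. the tree's `qSimSign_polyTimeReducible_jonesApprox` for the idiom).
* `stub_guidedAmplification` (THE BET, open; size: the crux lives here) — for every `c` and `χ₁ > 0`
  there are `K` and `χ₀ > 0` with a Karp reduction `GLH'(c, χ₁) ≤ₚ GLH(K, χ₀)`: a GUIDE-TRANSPORTING
  amplification of the relative promise gap from `1/(n^c + c)` to `1/(K ⌊log₂ n⌋² + 1)` (card
  no-dinur-for-guided-hamiltonians, hypothesis GGA weakened from constant precision to `1/log² n`).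
  Why it might fail: with `NeedleBPP` it yields `BQP ⊆ BPP`; no guide-transporting amplification is in
  print — same-eigenstate spectral gap amplification is black-box impossible beyond quadratic
  [SommaBoixo2013], perturbative gadgets shrink relative gaps (arXiv:2302.11578 Thm 1.5), history states
  have relative gap `O(1/T)`; padding cannot help (to turn `1/(n^c + c)` into `1/(K log² n' + 1)` by the
  identity one needs `n' ≥ 2^{Ω(n^{c/2})}` qubits, and every promise instance has `Λ > 0`, i.e. at least
  one `2n'`-bit term, so the output would be exponentially long).  Degenerate corner recorded: for
  `c = 0` the schedule is the constant `1` and the identity map works — the content is `c ≥ 1`.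
* Glue (sorry-free, standard axioms): `compose` takes `c, χ₁` from clock hardness, `K, χ₀` from
  amplification at `(c, χ₁)`, and composes the two Karp reductions with
  `Literature.Computability.Complexity.PromiseProblem.PolyTimeReducible.trans_holds` (Goldreich 2006
  §1.2 Def. 3; `PromiseProofs.lean`); `GuidedHardness_of : GuidedHardness` applies it to the two stubs and
  is the ONLY theorem whose head is the crux (BY NAME; the inlined problem is `GLH(K, χ₀)` by `rfl`).

Disproof used: none exists for this crux (`ledger crux ls stmt-QuantumAdvantage-9895`: no workfiles —
no `Disproof.lean`, no landed `Theorems/GuidedHardness/Negative/*`); `ledger negatives --problem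
QuantumAdvantage` has no statement about guided Hamiltonians.  The route header records why
`GuidedHardness` (hence `stub_guidedAmplification`) cannot be refuted outright without separating
classes (its negation puts a BQP language outside the Karp-closure of a PromiseBPP' problem).

`sorry` occurs ONLY in the two `stub_*` theorems.
-/

-- `Summit.<Summit>.<Problem>`: for the single-conjunct summit the duplicate `QuantumAdvantage.QuantumAdvantage` is mandated.
set_option linter.dupNamespace false

namespace Summit.QuantumAdvantage.QuantumAdvantage.Cruxes.GuidedHardness.Birth

open Summit.QuantumAdvantage.QuantumAdvantage.Theses.NeedleThreshold
open Literature.Computability.Complexity Literature.Computability.QuantumComplexity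

/-! ## The two registered stubs (signatures fully qualified; registered verbatim) -/

/-- **Stub 1 — clock hardness at inverse-polynomial precision** (known in print; XL to formalise).
For some `c : ℕ` and `χ₁ > 0`, every `L ∈ BQP` Karp-reduces, as the promise problem `ofLanguage L`, to
the guided Pauli-Hamiltonian problem with precision schedule `n^c + c` and overlap `χ₁`:
`GLH'(c, χ₁)` is BQP-hard.  [GharibianLegall2022, Thm 2] transcribed to the route's instance format
(Clifford+T Kitaev clock scaled into `ℤ[√2]` weights, pre-idled subset-state guide over clock values,
perturbed history state as the guided eigenvector); overlap improvable towards `1 − 1/poly`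
[CadeEtAl2022].  Leans on: `Literature.Computability.Cryptography.BQP` (uniform Clifford+T families),
`guidedPauliHamiltonianProblem'`, `PromiseProblem.PolyTimeReducible` (an `FP` witness).
Sources: GharibianLegall2022 (arXiv:2111.09079) Thm 2; CadeEtAl2022; KitaevShenVyalyi2002 §14.4. -/
theorem stub_clockHardness :
    ∃ (c : ℕ) (χ₁ : ℝ), 0 < χ₁ ∧ ∀ L ∈ Literature.Computability.Cryptography.BQP,
      (Literature.Computability.Complexity.PromiseProblem.ofLanguage L).PolyTimeReducible
        (Literature.Computability.QuantumComplexity.guidedPauliHamiltonianProblem' c χ₁) := by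
  sorry

/-- **Stub 2 — guided gap amplification** (LOAD-BEARING; the open bet of the route).  For every
precision exponent `c` and overlap `χ₁ > 0` there are `K : ℕ` and `χ₀ > 0` and a Karp reduction of
promise problems `GLH'(c, χ₁) ≤ₚ GLH(K, χ₀)`: the relative promise gap is amplified from `1/(n^c + c)`
to `1/(K ⌊log₂ n⌋² + 1)` while a signed subset-state guide of constant overlap is transported to the
new instance (YES: a guided eigenvector at energy `≤ a'Λ'`; NO: spectrum `≥ b'Λ'`).  Why plausibly
true: it is strictly weaker than the constant-precision guided amplification conjectured in
[WeggemansFolkertsmaCade2023, §1 / Thm 1.5 discussion] and on the hub (card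
no-dinur-for-guided-hamiltonians, GGA); the target precision `1/log² n` is exactly the classical needle
threshold of the route.  Why it might fail: black-box same-eigenstate gap amplification stops at
quadratic [SommaBoixo2013]; perturbative gadgets lose relative gap (arXiv:2302.11578 Thm 1.5); with
`NeedleBPP` it collapses `BQP ⊆ BPP`.  (For `c = 0` the identity map is a reduction; the content is
`c ≥ 1`.)  Leans on: `guidedPauliHamiltonianProblem'`, `guidedPauliHamiltonianProblem`,
`PromiseProblem.PolyTimeReducible`.  Sources: GharibianLegall2022 §1; WeggemansFolkertsmaCade2023;
SommaBoixo2013; arXiv:2302.11578. -/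
theorem stub_guidedAmplification :
    ∀ (c : ℕ) (χ₁ : ℝ), 0 < χ₁ → ∃ (K : ℕ) (χ₀ : ℝ), 0 < χ₀ ∧
      (Literature.Computability.QuantumComplexity.guidedPauliHamiltonianProblem' c χ₁).PolyTimeReducible
        (Literature.Computability.QuantumComplexity.guidedPauliHamiltonianProblem K χ₀) := by
  sorry

/-! ## Sorry-free glue -/

/-- The crux, restated over the Literature name: `GuidedHardness` is literally (`Iff.rfl`, via
`guidedPauliHamiltonianProblem_eq : … = <the inlined term>` by `rfl`) BQP-hardness of
`guidedPauliHamiltonianProblem K χ₀` for some `K` and `χ₀ > 0`. [folklore] -/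
theorem guidedHardness_iff :
    GuidedHardness ↔
      ∃ (K : ℕ) (χ₀ : ℝ), 0 < χ₀ ∧ ∀ L ∈ Literature.Computability.Cryptography.BQP,
        (PromiseProblem.ofLanguage L).PolyTimeReducible (guidedPauliHamiltonianProblem K χ₀) :=
  Iff.rfl

/-- **Composition of the line** (the real glue, sorry-free, hypotheses = the two stub signatures,
conclusion = the right-hand side of `guidedHardness_iff`): clock hardness at precision `1/(n^c + c)`
composed with a guide-transporting amplification `GLH'(c, χ₁) ≤ₚ GLH(K, χ₀)` gives BQP-hardness of
`GLH(K, χ₀)` — transitivity of Karp reductions among promise problems,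
`PromiseProblem.PolyTimeReducible.trans_holds` [Goldreich 2006, §1.2 Def. 3]. -/
theorem compose
    (hclock : ∃ (c : ℕ) (χ₁ : ℝ), 0 < χ₁ ∧ ∀ L ∈ Literature.Computability.Cryptography.BQP,
      (Literature.Computability.Complexity.PromiseProblem.ofLanguage L).PolyTimeReducible
        (Literature.Computability.QuantumComplexity.guidedPauliHamiltonianProblem' c χ₁))
    (hamp : ∀ (c : ℕ) (χ₁ : ℝ), 0 < χ₁ → ∃ (K : ℕ) (χ₀ : ℝ), 0 < χ₀ ∧
      (Literature.Computability.QuantumComplexity.guidedPauliHamiltonianProblem' c χ₁).PolyTimeReducible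
        (Literature.Computability.QuantumComplexity.guidedPauliHamiltonianProblem K χ₀)) :
    ∃ (K : ℕ) (χ₀ : ℝ), 0 < χ₀ ∧ ∀ L ∈ Literature.Computability.Cryptography.BQP,
      (PromiseProblem.ofLanguage L).PolyTimeReducible (guidedPauliHamiltonianProblem K χ₀) := by
  obtain ⟨c, χ₁, hχ₁, hhard⟩ := hclock
  obtain ⟨K, χ₀, hχ₀, hred⟩ := hamp c χ₁ hχ₁
  exact ⟨K, χ₀, hχ₀, fun L hL => PromiseProblem.PolyTimeReducible.trans_holds (hhard L hL) hred⟩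

/-- **The skeleton theorem**: the crux `GuidedHardness` BY NAME from the two stubs (kernel-checked
composition `compose` + `guidedHardness_iff`; its only `sorry`s are inside `stub_clockHardness` and
`stub_guidedAmplification`).  When both stubs land sorry-free this is the proof of item
stmt-QuantumAdvantage-9895. -/
theorem GuidedHardness_of : GuidedHardness :=
  guidedHardness_iff.2 (compose stub_clockHardness stub_guidedAmplification)

end Summit.QuantumAdvantage.QuantumAdvantage.Cruxes.GuidedHardness.Birth
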